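import Literature.AnabelianGeometry.EtaleTheta.Discharge.Sec3Cor38Transport
import Literature.AnabelianGeometry.EtaleTheta.Discharge.Sec3Def36NonzeroConstants
import Literature.AnabelianGeometry.EtaleTheta.Discharge.Sec3Cor38Rows
import Literature.AnabelianGeometry.EtaleTheta.Discharge.Sec3Cor38CriterionSlice
import Literature.AnabelianGeometry.EtaleTheta.Discharge.Sec3Thm37Standard
import Literature.AnabelianGeometry.EtaleTheta.Discharge.Sec3Thm37
import Literature.AnabelianGeometry.EtaleTheta.Discharge.Sec3Cor38StdIsoNotGL
import Literature.AlgebraicGeometry.Frobenioids.ModelFrobenioidTypeBridge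
import Literature.AlgebraicGeometry.Frobenioids.IsoSubanchorNotIsotropic
import Literature.AlgebraicGeometry.Frobenioids.CategoryTheoreticityFacts
import Literature.AlgebraicGeometry.Frobenioids.EquivalenceThm34OfThm34ii
import Literature.AlgebraicGeometry.Frobenioids.PerfectionFunctoriality
import Literature.AlgebraicGeometry.Frobenioids.PerfectionFunctorialityCompatibleClosure
import Literature.AlgebraicGeometry.Frobenioids.PerfectionIsFrobenioid
import Literature.AlgebraicGeometry.Frobenioids.PerfectionStandardTypes
import HarnessLib

/-!
# [EtTh] Corollary 3.8 (i) — END-TO-END ASSEMBLY of the sub-DAG: the typed statement `Cor38_i` from the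
# Def. 3.3/3.6 data alone, every [FrdI] input DISCHARGED by the tree's theorems

Mochizuki, *The étale theta function and its Frobenioid-theoretic manifestations*, Publ. RIMS **45** (2009),
Cor. 3.8 (i) "Preservation of Base-field-theoretic Morphisms", PDF pp. 80–81 (printed 306–307), proof PDF
p. 81 [cite: MochizukiEtTh2009, Cor 3.8 p.81]:

> "(i) Suppose, for `i = 1, 2`, that the base category `D_i` of `C_i` is Frobenius-slim. Then `Ψ` preserves the
> base-field-theoretic morphisms."

abc-iut cell, layer L2, node `EtTh:Cor3.8(i)` (seat abc-iut-w6-d039; PROOF-ONLY companion, 0 definitions).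
abc-iut-w5-d124's sub-DAG (`TemperedFrobenioidCor38Sub.lean` p414329, plan/L2/SUBDAG-EtTh-Cor38.md) typed one row
per sentence of the printed proof and landed every row; this file COMPOSES them into the node-level statement
`Cor38_i (fun E _ => IsFrobeniusSlim E) h` of abc-iut-L2-t3 (`TemperedFrobenioidProps.lean`), citing BY NAME:

* rows: `Cor38Hyp.cor38_i_of_rows` (C38-L08 assembly), `preservesPreSteps_of_thm34ii` (L02a),
  `preservesFactorisation_of_thm34` (L07), `TemperedFrobenioid.hasFactorisations_of_isFrobenioid` (L07c),
  `bsFldOfFactorisation_of_isFrobenioid` (L07b, `Sec3Cor38Rows`), the TRANSPORT row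
  `Cor38Hyp.preservesBsFldPreSteps_of_criterion` (L06, `Sec3Cor38Transport`) and the CRITERION row
  `TemperedFrobenioid.bsFldPreStepLimitCriterion_of_line` (L05, `Sec3Cor38Criterion` + `Sec3Def36NonzeroConstants`);
* the printed inputs "[Mzk17], Theorem 3.4, (ii), (iii), (iv)": (ii) enters as ONE named-fact binder `h34` =
  abc-iut-L1-t3's `FrdI.Thm34ii` (2008 wording, cell FACT-LIST F-0711) at the universes of tempered Frobenioids —
  a THEOREM of the tree (`FrdI.Thm34ii_holds`, abc-iut-L1-t11/t13, `EquivalencePreStepsFSMFF2008Assembly` p427329;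
  the sequel `Sec3Cor38iAssemblyHolds.lean` instantiates `h34 := FrdI.Thm34ii_holds` once that module's olean is
  built on the farm) — and (iii), (iv) are its PROVED consequences `FrdI.thm34iii_ofFunctor_of_thm34ii`,
  `FrdI.thm34iv_ofFunctor_of_thm34ii` (`EquivalenceThm34OfThm34ii`); all three applied to `Ψ`, to `Ψ⁻¹`, AND — as
  print does implicitly on p. 81 ("its image in `C_i^pf` …", Rmk. 3.6.4) — to the equivalence of PERFECTIONS
  `Ψ^pf := (PreFrobenioid.Perfection.map hΨ).asEquivalence` of [FrdI] Thm. 3.4 (iii) (abc-iut-L1-d1's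
  `PerfectionFunctoriality`: `map_isEquivalence`, `toPfCompMapIso`; Frobenius-compatibility of `Ψ` from Thm. 3.4
  (iii), `PreFrobenioid.isFrobeniusCompatible_of_thm34iii_ofFunctor`), the perfections being Frobenioids of
  standard type over the same bases ([FrdI] Prop. 3.2 (iii) `PreFrobenioid.Perfection.isFrobenioid`, Prop. 5.5
  (iii) clauses `PerfectionStandardTypes`; the round trip `PreFrobenioidData.ofFunctor_toFunctor` is `rfl`);
* "by Theorem 3.7, (i), (ii), `C₁`, `C₂` are of standard and isotropic type, but not of group-like type":
  abc-iut-w5-d135's `opsData_isOfIsotropicType`, `opsData_not_isOfGroupLikeType` (unconditional, `Sec3Cor38StdIsoNotGL`)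
  and Thm. 3.7 (ii) "standard type" = hypothesis `hstd_i` BY NAME (discharged at the canonical vocabularies by
  `opsData_isOfStandardType_treeCatVocab`, see `cor38_i_treeVocab_of_thm34ii`); hypothesis (b) of [FrdI] Thm. 3.4
  is VACUOUS for Frobenioids not of group-like type (`hypB_of_not_isOfGroupLikeType`).

WHAT REMAINS EXPLICIT in `Cor38Hyp.cor38_i_of_thm34ii` (all BY NAME, no new `Prop`): `h34` (F-0711, a tree theorem,
see above), `hF_i : IsFrobenioid C_i.toElem` ([FrdI] Thm. 5.2 (ii); at `treeCatVocab` = `hBmon`, abc-iut-L2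
`isFrobenioid_treeCatVocab_of_isMonoidOn`), `hstd_i` ([EtTh] Thm. 3.7 (ii)), and the four DATA binders per side of
row C38-L05 in the shapes of `bsFldPreStepLimitCriterion_of_line` VERBATIM — `hP34Λ` (cell GAP-LEDGER G-w5d124-1
≡ abc-iut-L2-t3's typed field `Prop34Cnst.mem_FΛ_of_divΛ_eq_of`), `hLine`/`hInt` (G-w5d124-2 reduced, abc-iut-w4-d008
`Sec3Def36NonzeroConstants`), `hSup` (G-w5d124-3) — kernel-NECESSARY by abc-iut-w5-d124's `Sec3Cor38CriterionToy`.
`cor38_i_treeVocab_of_thm34ii`: at the canonical vocabularies (`treeMonoidVocab`, `treeCatVocab`) the inputs are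
`h34`, `hBmon₁`, `hBmon₂` ([FrdI] Thm. 5.2 preamble "`𝔹` a monoid on `D`") and the data binders ONLY.
HONEST FRAMING: refereed pre-IUT material ([EtTh] §3 over [FrdI] §§3, 5); nothing here bears on [IUTchIII]
Cor. 3.12; no statement of either paper is restated or strengthened; typed ≠ proved — here PROVED modulo the
named data binders.
-/

namespace Literature.AnabelianGeometry.EtaleTheta

open CategoryTheory Opposite Literature.AlgebraicGeometry.Frobenioids

universe u₀ v₀ u v w

variable {D₀ : Type u₀} [Category.{v₀} D₀] {V : FrdIMonoidStub.{w}}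
  {T : RealifiedDivisorMonoids (D₀ := D₀) V} {D : Type u} [Category.{v} D] {VD : FrdICatStub.{u, v, w} D}

/-! ### §1 One tempered Frobenioid: the type clauses of Thm. 3.7 in L1's operations language, for `C` and `C^pf` -/

namespace TemperedFrobenioid

variable (C : TemperedFrobenioid T D VD)

/-- Thm. 3.7 (i) ⟹ "of quasi-isotropic type" ([FrdI] Rmk. 3.1.1: an isotropic object of a Frobenioid is not an
iso-subanchor), the hypothesis of [FrdI] Thm. 3.4 (ii). [cite: MochizukiEtTh2009, Thm 3.7 p.79] -/
theorem opsData_isOfQuasiIsotropicType (hF : PreFrobenioid.IsFrobenioid C.toElem) :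
    C.opsData.IsOfQuasiIsotropicType :=
  isOfQuasiIsotropicType_of_isOfIsotropicType _ _ hF C.opsData_isOfIsotropicType

/-- Hence `C` admits a non-group-like object (the hypothesis "`C₁`, `C₂` admit a non-group-like object" under
which [FrdI] Thm. 3.4 (iii) gives `Ψ^{ℕ≥1} = id`). [cite: MochizukiEtTh2009, Thm 3.7 p.79] -/
theorem opsData_exists_not_isGroupLikeObj : ∃ A : C.category, ¬ C.opsData.IsGroupLikeObj A :=
  not_forall.1 C.thm37_i_not_groupLike

/-- **[FrdI] Prop. 3.2 (iii) for a tempered Frobenioid**: THE perfection `C^pf` (abc-iut-L1-d9's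
`PreFrobenioidData.perfection hF`) with its structure functor `C^pf → F_{Φ^pf}` is a Frobenioid — `C` being of
Frobenius-isotropic type (Thm. 3.7 (i), `isOfType_isFrobeniusIsotropic`). "The perfection … of a tempered
Frobenioid [is] again [a] tempered Frobenioid" (Rmk. 3.6.4, p.79) is used in print exactly through this.
[cite: MochizukiEtTh2009, Rmk 3.6.4 p.79] -/
theorem perfection_ops_isFrobenioid (hF : PreFrobenioid.IsFrobenioid C.toElem) :
    PreFrobenioid.IsFrobenioid (PreFrobenioidData.perfection hF).ops.toFunctor :=
  PreFrobenioid.Perfection.isFrobenioid hF (C.isOfType_isFrobeniusIsotropic hF)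

/-- `C^pf` is of quasi-isotropic type ([FrdI] Prop. 3.2 (iii) "isotropic type" + Rmk. 3.1.1).
[cite: MochizukiEtTh2009, Rmk 3.6.4 p.79] -/
theorem perfection_ops_isOfQuasiIsotropicType (hF : PreFrobenioid.IsFrobenioid C.toElem) :
    (PreFrobenioidData.perfection hF).ops.IsOfQuasiIsotropicType :=
  PreFrobenioid.Perfection.isOfQuasiIsotropicType_ops hF (C.perfection_ops_isFrobenioid hF)
    (C.isOfType_isFrobeniusIsotropic hF)

/-- `C^pf` is not of group-like type (group-like type is detected on `C`,
`PreFrobenioid.Perfection.isOfGroupLikeType_ops_iff`). [cite: MochizukiEtTh2009, Rmk 3.6.4 p.79] -/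
theorem perfection_ops_not_isOfGroupLikeType (hF : PreFrobenioid.IsFrobenioid C.toElem) :
    ¬ (PreFrobenioidData.perfection hF).ops.IsOfGroupLikeType := fun hGL =>
  C.opsData_not_isOfGroupLikeType ((PreFrobenioid.Perfection.isOfGroupLikeType_ops_iff hF).mp hGL)

/-- **`C^pf` is of standard type when `C` is** ([FrdI] Prop. 5.5 (iii), clauses (a), (c), (d), (e) by abc-iut-w5-d042's
`PerfectionStandardTypes`; clause (b) vacuous, `C^pf` not being of group-like type). This is the form in which
print applies [FrdI] Thm. 3.4 to `Ψ^pf` ("the perfection … [is] again [a] tempered Frobenioid", Rmk. 3.6.4).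
[cite: MochizukiEtTh2009, Rmk 3.6.4 p.79] -/
theorem perfection_ops_isOfStandardType (hF : PreFrobenioid.IsFrobenioid C.toElem)
    (hstd : C.opsData.IsOfStandardType) : (PreFrobenioidData.perfection hF).ops.IsOfStandardType where
  quasiIsotropic := C.perfection_ops_isOfQuasiIsotropicType hF
  frobeniusIsotropic :=
    PreFrobenioid.Perfection.isOfFrobeniusIsotropicType_ops hF (C.isOfType_isFrobeniusIsotropic hF)
  frobeniusCompact_of_groupLike := fun hGL => (C.perfection_ops_not_isOfGroupLikeType hF hGL).elim
  frobeniusNormalized := PreFrobenioid.Perfection.isOfFrobeniusNormalizedType_ops hF hstd.frobeniusNormalized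
  fsmff := hstd.fsmff
  nonDilating := PreFrobenioid.Perfection.isNonDilatingOn_ops hF hstd.nonDilating

end TemperedFrobenioid

/-- **Hypothesis (b) of [FrdI] Thm. 3.4 (iii)–(v) is vacuous for Frobenioids not of group-like type** ("if
`C₁`, `C₂` are of group-like type, then …"; tempered Frobenioids are not, Thm. 3.7 (i)). Pure logic.
[cite: MochizukiFrdI2008, Thm. 3.4 (iii) p.62] -/
theorem hypB_of_not_isOfGroupLikeType {E₁ : Type*} [Category E₁] {B₁ : Type*} [Category B₁]
    {E₂ : Type*} [Category E₂] {B₂ : Type*} [Category B₂] (S₁ : PreFrobenioidData E₁ B₁)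
    (S₂ : PreFrobenioidData E₂ B₂) (Ψ : E₁ ≌ E₂) (h : ¬ S₁.IsOfGroupLikeType) :
    PreFrobenioidData.HypB S₁ S₂ Ψ := fun h₁ _ => (h h₁).elim

/-! ### §2 The assembly -/

section Assembly

variable {D₀' : Type u₀} [Category.{v₀} D₀'] {T' : RealifiedDivisorMonoids (D₀ := D₀') V}
  {D' : Type u} [Category.{v} D'] {VD' : FrdICatStub.{u, v, w} D'}
  {C₁ : TemperedFrobenioid T D VD} {C₂ : TemperedFrobenioid T' D' VD'} (h : Cor38Hyp C₁ C₂)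

open TemperedFrobenioid

/-- **C38-L01 DISCHARGED** ("by Theorem 3.7, (i), (ii), `C₁`, `C₂` are of standard and isotropic type, but not of
group-like type", p.81 l.13–14): `h.StandardIsotropicNotGroupLike` from Thm. 3.7 (ii) "standard type" BY NAME
(`hstd_i`) and the unconditional Thm. 3.7 (i) clauses. [cite: MochizukiEtTh2009, Cor 3.8 p.81] -/
theorem Cor38Hyp.standardIsotropicNotGroupLike_of (hstd₁ : C₁.opsData.IsOfStandardType)
    (hstd₂ : C₂.opsData.IsOfStandardType) : h.StandardIsotropicNotGroupLike :=
  ⟨⟨hstd₁, hstd₂⟩, ⟨C₁.opsData_isOfIsotropicType, C₂.opsData_isOfIsotropicType⟩,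
    ⟨C₁.opsData_not_isOfGroupLikeType, C₂.opsData_not_isOfGroupLikeType⟩⟩

/-- "`Ψ` is compatible with the operation of passing to the perfection [cf. [Mzk17], Theorem 3.4, (iii)]"
(p.81 l.15–16), CONSTRUCTIVELY: `Ψ` is Frobenius-compatible (arrows of Frobenius type to such, same degrees) by
[FrdI] Thm. 3.4 (iii) (`FrdI.thm34iii_ofFunctor_of_thm34ii` over the named fact `h34` = Thm. 3.4 (ii)), so that
abc-iut-L1-d1's `PreFrobenioid.Perfection.map` is defined on it. [cite: MochizukiEtTh2009, Cor 3.8 p.81] -/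
theorem Cor38Hyp.isFrobeniusCompatible_of
    (h34 : Literature.AlgebraicGeometry.Frobenioids.FrdI.Thm34ii.{w, v, max v w, u, max u w})
    (hF₁ : PreFrobenioid.IsFrobenioid C₁.toElem)
    (hF₂ : PreFrobenioid.IsFrobenioid C₂.toElem) (hstd₁ : C₁.opsData.IsOfStandardType)
    (hstd₂ : C₂.opsData.IsOfStandardType) :
    PreFrobenioid.IsFrobeniusCompatible C₁.toElem C₂.toElem h.Ψ.functor :=
  PreFrobenioid.isFrobeniusCompatible_of_thm34iii_ofFunctor h.Ψ
    (FrdI.thm34iii_ofFunctor_of_thm34ii hF₁ hF₂ h.Ψ (h34 _ _ hF₁ hF₂ h.Ψ) (h34 _ _ hF₂ hF₁ h.Ψ.symm))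
    hstd₁ hstd₂ (hypB_of_not_isOfGroupLikeType _ _ _ C₁.opsData_not_isOfGroupLikeType)
    C₁.opsData_exists_not_isGroupLikeObj C₂.opsData_exists_not_isGroupLikeObj

/-- **C38-L06 DISCHARGED modulo the data binders** ("Thus, `Ψ` preserves the base-field-theoretic pre-steps",
p.81 l.27–28), for Frobenius-slim `D₁`, `D₂`: the criterion C38-L05 on both sides
(`bsFldPreStepLimitCriterion_of_line`) transported (`preservesBsFldPreSteps_of_criterion`) along the equivalence
of perfections `Ψ^pf = (Perfection.map hΨ).asEquivalence`, which `1`-commutes with `C_i → C_i^pf`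
(`toPfCompMapIso`) and preserves co-angular pre-steps and `O^▷(−)` of the perfections by [FrdI] Thm. 3.4 (ii)
(`h34`), (iv) (`FrdI.thm34iv_ofFunctor_of_thm34ii`) applied to `Ψ^pf` and `(Ψ^pf)⁻¹` (the `C_i^pf` are Frobenioids
of standard type over the same Frobenius-slim bases, not of group-like type). [cite: MochizukiEtTh2009, Cor 3.8 p.81] -/
theorem Cor38Hyp.preservesBsFldPreSteps_of_thm34ii
    (h34 : Literature.AlgebraicGeometry.Frobenioids.FrdI.Thm34ii.{w, v, max v w, u, max u w})
    (hF₁ : PreFrobenioid.IsFrobenioid C₁.toElem)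
    (hF₂ : PreFrobenioid.IsFrobenioid C₂.toElem) (hstd₁ : C₁.opsData.IsOfStandardType)
    (hstd₂ : C₂.opsData.IsOfStandardType)
    (hP34Λ₁ : ∀ (Y : D₀ᵒᵖ) (b : T.BΛ.obj Y) (r : T.ΦR.obj Y),
      T.divΛ Y b = Algebra.GrothendieckGroup.of r → b ∈ T.FΛ Y)
    (hLine₁ : ∀ (Y : D₀ᵒᵖ) (g : Algebra.GrothendieckGroup (T.ΦR.obj Y)), g ∈ T.cnstR Y →
      ∃ r : T.ΦR.obj Y, g = Algebra.GrothendieckGroup.of r ∨ g = (Algebra.GrothendieckGroup.of r)⁻¹)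
    (hInt₁ : ∀ Y : D₀ᵒᵖ, IsCancelMul (T.ΦR.obj Y))
    (hSup₁ : ∀ (W : D) (m : Perfection (C₁.divisorMonoid.obj (op W)))
      (U : Set (Perfection (C₁.divisorMonoid.obj (op W)))),
      U ⊆ C₁.bsFldPf W → U.Nonempty → (∀ u ∈ U, u ∣ m) →
        ∃ y ∈ C₁.bsFldPf W, (∀ u ∈ U, u ∣ y) ∧ y ∣ m)
    (hP34Λ₂ : ∀ (Y : D₀'ᵒᵖ) (b : T'.BΛ.obj Y) (r : T'.ΦR.obj Y),
      T'.divΛ Y b = Algebra.GrothendieckGroup.of r → b ∈ T'.FΛ Y)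
    (hLine₂ : ∀ (Y : D₀'ᵒᵖ) (g : Algebra.GrothendieckGroup (T'.ΦR.obj Y)), g ∈ T'.cnstR Y →
      ∃ r : T'.ΦR.obj Y, g = Algebra.GrothendieckGroup.of r ∨ g = (Algebra.GrothendieckGroup.of r)⁻¹)
    (hInt₂ : ∀ Y : D₀'ᵒᵖ, IsCancelMul (T'.ΦR.obj Y))
    (hSup₂ : ∀ (W : D') (m : Perfection (C₂.divisorMonoid.obj (op W)))
      (U : Set (Perfection (C₂.divisorMonoid.obj (op W)))),
      U ⊆ C₂.bsFldPf W → U.Nonempty → (∀ u ∈ U, u ∣ m) →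
        ∃ y ∈ C₂.bsFldPf W, (∀ u ∈ U, u ∣ y) ∧ y ∣ m)
    (hFs : IsFrobeniusSlim D) (hFs' : IsFrobeniusSlim D') : h.PreservesBsFldPreSteps := by
  -- [FrdI] Thm. 3.4 (ii) for `Ψ`, `Ψ⁻¹` (named fact `h34`) ⟹ C38-L02a
  have hps : h.PreservesPreSteps :=
    h.preservesPreSteps_of_thm34ii (h34 _ _ hF₁ hF₂ h.Ψ) (h34 _ _ hF₂ hF₁ h.Ψ.symm)
      (C₁.opsData_isOfQuasiIsotropicType hF₁) (C₂.opsData_isOfQuasiIsotropicType hF₂)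
  -- C38-L05 on both sides (modulo the data binders)
  have hc₁ := C₁.bsFldPreStepLimitCriterion_of_line hF₁ hP34Λ₁ hLine₁ hInt₁ hSup₁
  have hc₂ := C₂.bsFldPreStepLimitCriterion_of_line hF₂ hP34Λ₂ hLine₂ hInt₂ hSup₂
  -- C38-L03, constructively: `Ψ^pf` and its square
  have hΨ := h.isFrobeniusCompatible_of h34 hF₁ hF₂ hstd₁ hstd₂
  haveI := PreFrobenioid.Perfection.map_isEquivalence (hF₁ := hF₁) (hF₂ := hF₂) h.Ψ hΨ
  let G : (PreFrobenioidData.perfection hF₁).Pf ≌ (PreFrobenioidData.perfection hF₂).Pf :=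
    (PreFrobenioid.Perfection.map (hF₁ := hF₁) (hF₂ := hF₂) hΨ).asEquivalence
  have hcomm : OneCommutes h.Ψ.functor (PreFrobenioidData.perfection hF₂).toPf
      (PreFrobenioidData.perfection hF₁).toPf G.functor :=
    ⟨(PreFrobenioid.Perfection.toPfCompMapIso (hF₁ := hF₁) (hF₂ := hF₂) hΨ).symm⟩
  -- the perfections are Frobenioids of standard type, not of group-like type
  have hPf₁ := C₁.perfection_ops_isFrobenioid hF₁
  have hPf₂ := C₂.perfection_ops_isFrobenioid hF₂
  have hq₁ := C₁.perfection_ops_isOfQuasiIsotropicType hF₁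
  have hq₂ := C₂.perfection_ops_isOfQuasiIsotropicType hF₂
  have hs₁ := C₁.perfection_ops_isOfStandardType hF₁ hstd₁
  have hs₂ := C₂.perfection_ops_isOfStandardType hF₂ hstd₂
  have hB : PreFrobenioidData.HypB (PreFrobenioidData.perfection hF₁).ops
      (PreFrobenioidData.perfection hF₂).ops G :=
    hypB_of_not_isOfGroupLikeType _ _ _ (C₁.perfection_ops_not_isOfGroupLikeType hF₁)
  have hB' : PreFrobenioidData.HypB (PreFrobenioidData.perfection hF₂).ops
      (PreFrobenioidData.perfection hF₁).ops G.symm :=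
    hypB_of_not_isOfGroupLikeType _ _ _ (C₂.perfection_ops_not_isOfGroupLikeType hF₂)
  -- [FrdI] Thm. 3.4 (ii), (iv) for `Ψ^pf`, `(Ψ^pf)⁻¹` (`ofFunctor_toFunctor` is `rfl`)
  have g2 : (PreFrobenioidData.perfection hF₁).ops.Thm34ii (PreFrobenioidData.perfection hF₂).ops G :=
    h34 _ _ hPf₁ hPf₂ G
  have g2' : (PreFrobenioidData.perfection hF₂).ops.Thm34ii (PreFrobenioidData.perfection hF₁).ops G.symm :=
    h34 _ _ hPf₂ hPf₁ G.symm
  have g4 : (PreFrobenioidData.perfection hF₁).ops.Thm34iv (PreFrobenioidData.perfection hF₂).ops G :=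
    FrdI.thm34iv_ofFunctor_of_thm34ii hPf₁ hPf₂ G g2 g2'
  have g4' : (PreFrobenioidData.perfection hF₂).ops.Thm34iv (PreFrobenioidData.perfection hF₁).ops G.symm :=
    FrdI.thm34iv_ofFunctor_of_thm34ii hPf₂ hPf₁ G.symm g2' g2
  obtain ⟨-, hG, -⟩ := g2 hq₁ hq₂ h.fsmff.1 h.fsmff.2
  obtain ⟨-, hG', -⟩ := g2' hq₂ hq₁ h.fsmff.2 h.fsmff.1
  obtain ⟨hGe, -, -⟩ := g4 hs₁ hs₂ hB hFs hFs'
  obtain ⟨hGe', -, -⟩ := g4' hs₂ hs₁ hB' hFs' hFs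
  exact h.preservesBsFldPreSteps_of_criterion _ _ hps hc₁ hc₂ G hcomm hG hG' hGe hGe'

/-- **[EtTh] Corollary 3.8 (i) — the typed statement `Cor38_i` of abc-iut-L2-t3, END TO END** (node
`EtTh:Cor3.8(i)`): for tempered Frobenioids `C₁`, `C₂` whose model Frobenioids are Frobenioids ([FrdI] Thm. 5.2
(ii), `hF_i`) of standard type ([EtTh] Thm. 3.7 (ii), `hstd_i`), under the standing hypotheses `Cor38Hyp` and
GIVEN the four printed properties of the Def. 3.3/3.6 (i) data per side (`hP34Λ`, `hLine`, `hInt`, `hSup` — cell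
GAP-LEDGER G-w5d124-1/2/3, kernel-necessary by `Sec3Cor38CriterionToy`): if `D₁`, `D₂` are Frobenius-slim then
`Ψ` preserves the base-field-theoretic morphisms. The [FrdI] Thm. 3.4 inputs of the printed proof (for `Ψ` and for
`Ψ^pf`) all flow from the ONE named fact `h34` = [FrdI] Thm. 3.4 (ii) (F-0711; `FrdI.Thm34ii_holds` in the tree).
[cite: MochizukiEtTh2009, Cor 3.8 p.80] -/
theorem Cor38Hyp.cor38_i_of_thm34ii
    (h34 : Literature.AlgebraicGeometry.Frobenioids.FrdI.Thm34ii.{w, v, max v w, u, max u w})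
    (hF₁ : PreFrobenioid.IsFrobenioid C₁.toElem)
    (hF₂ : PreFrobenioid.IsFrobenioid C₂.toElem) (hstd₁ : C₁.opsData.IsOfStandardType)
    (hstd₂ : C₂.opsData.IsOfStandardType)
    (hP34Λ₁ : ∀ (Y : D₀ᵒᵖ) (b : T.BΛ.obj Y) (r : T.ΦR.obj Y),
      T.divΛ Y b = Algebra.GrothendieckGroup.of r → b ∈ T.FΛ Y)
    (hLine₁ : ∀ (Y : D₀ᵒᵖ) (g : Algebra.GrothendieckGroup (T.ΦR.obj Y)), g ∈ T.cnstR Y →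
      ∃ r : T.ΦR.obj Y, g = Algebra.GrothendieckGroup.of r ∨ g = (Algebra.GrothendieckGroup.of r)⁻¹)
    (hInt₁ : ∀ Y : D₀ᵒᵖ, IsCancelMul (T.ΦR.obj Y))
    (hSup₁ : ∀ (W : D) (m : Perfection (C₁.divisorMonoid.obj (op W)))
      (U : Set (Perfection (C₁.divisorMonoid.obj (op W)))),
      U ⊆ C₁.bsFldPf W → U.Nonempty → (∀ u ∈ U, u ∣ m) →
        ∃ y ∈ C₁.bsFldPf W, (∀ u ∈ U, u ∣ y) ∧ y ∣ m)
    (hP34Λ₂ : ∀ (Y : D₀'ᵒᵖ) (b : T'.BΛ.obj Y) (r : T'.ΦR.obj Y),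
      T'.divΛ Y b = Algebra.GrothendieckGroup.of r → b ∈ T'.FΛ Y)
    (hLine₂ : ∀ (Y : D₀'ᵒᵖ) (g : Algebra.GrothendieckGroup (T'.ΦR.obj Y)), g ∈ T'.cnstR Y →
      ∃ r : T'.ΦR.obj Y, g = Algebra.GrothendieckGroup.of r ∨ g = (Algebra.GrothendieckGroup.of r)⁻¹)
    (hInt₂ : ∀ Y : D₀'ᵒᵖ, IsCancelMul (T'.ΦR.obj Y))
    (hSup₂ : ∀ (W : D') (m : Perfection (C₂.divisorMonoid.obj (op W)))
      (U : Set (Perfection (C₂.divisorMonoid.obj (op W)))),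
      U ⊆ C₂.bsFldPf W → U.Nonempty → (∀ u ∈ U, u ∣ m) →
        ∃ y ∈ C₂.bsFldPf W, (∀ u ∈ U, u ∣ y) ∧ y ∣ m) :
    Literature.AnabelianGeometry.EtaleTheta.Cor38_i
      (fun E _ => Literature.AlgebraicGeometry.Frobenioids.IsFrobeniusSlim E) h := by
  have H := h.standardIsotropicNotGroupLike_of hstd₁ hstd₂
  have hB := hypB_of_not_isOfGroupLikeType C₁.opsData C₂.opsData h.Ψ C₁.opsData_not_isOfGroupLikeType
  have hB' := hypB_of_not_isOfGroupLikeType C₂.opsData C₁.opsData h.Ψ.symm C₂.opsData_not_isOfGroupLikeType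
  -- [FrdI] Thm. 3.4 (ii) (named fact, 2008 wording) and (iii) (its tree consequence) for `Ψ`, `Ψ⁻¹`
  have h2 : C₁.opsData.Thm34ii C₂.opsData h.Ψ := h34 _ _ hF₁ hF₂ h.Ψ
  have h2' : C₂.opsData.Thm34ii C₁.opsData h.Ψ.symm := h34 _ _ hF₂ hF₁ h.Ψ.symm
  have h3 : C₁.opsData.Thm34iii C₂.opsData h.Ψ := FrdI.thm34iii_ofFunctor_of_thm34ii hF₁ hF₂ h.Ψ h2 h2'
  have h3' : C₂.opsData.Thm34iii C₁.opsData h.Ψ.symm :=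
    FrdI.thm34iii_ofFunctor_of_thm34ii hF₂ hF₁ h.Ψ.symm h2' h2
  -- rows C38-L02a, L07, L07c, L07b
  have hps : h.PreservesPreSteps :=
    h.preservesPreSteps_of_thm34ii h2 h2' (C₁.opsData_isOfQuasiIsotropicType hF₁)
      (C₂.opsData_isOfQuasiIsotropicType hF₂)
  have h7 : h.PreservesFactorisation := h.preservesFactorisation_of_thm34 hps h3 h3' H hB hB'
  -- C38-L08 assembly over C38-L06 (`preservesBsFldPreSteps_of_data`)
  exact h.cor38_i_of_rows
    (fun hFs hFs' => h.preservesBsFldPreSteps_of_thm34ii h34 hF₁ hF₂ hstd₁ hstd₂ hP34Λ₁ hLine₁ hInt₁ hSup₁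
      hP34Λ₂ hLine₂ hInt₂ hSup₂ hFs hFs')
    h7 (C₁.hasFactorisations_of_isFrobenioid hF₁) (C₁.bsFldOfFactorisation_of_isFrobenioid hF₁)
    (C₂.bsFldOfFactorisation_of_isFrobenioid hF₂)

end Assembly

/-! ### §3 At the canonical vocabularies: inputs `hBmon₁`, `hBmon₂` and the data binders only -/

section TreeVocab

variable {T₁ : RealifiedDivisorMonoids (D₀ := D₀) treeMonoidVocab.{w}}
  {IsRational IsStrictlyRational : (Dᵒᵖ ⥤ CommMonCat.{w}) → Prop}
  {D₀' : Type u₀} [Category.{v₀} D₀'] {T₂ : RealifiedDivisorMonoids (D₀ := D₀') treeMonoidVocab.{w}}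
  {D' : Type u} [Category.{v} D'] {IsRational' IsStrictlyRational' : (D'ᵒᵖ ⥤ CommMonCat.{w}) → Prop}
  {C₁ : TemperedFrobenioid T₁ D (treeCatVocab D IsRational IsStrictlyRational)}
  {C₂ : TemperedFrobenioid T₂ D' (treeCatVocab D' IsRational' IsStrictlyRational')} (h : Cor38Hyp C₁ C₂)

open TemperedFrobenioid

/-- **[EtTh] Corollary 3.8 (i) at the canonical [FrdI] vocabularies** (`treeMonoidVocab`: "non-dilating" is the
tree's; `treeCatVocab`: "divisorial monoid on `D`" is the tree's): `hF_i` is abc-iut-L2's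
`isFrobenioid_treeCatVocab_of_isMonoidOn` and Thm. 3.7 (ii) "standard type" is abc-iut-L2's
`isOfStandardType_treeCatVocab` (from `h.fsmff`, `h.nonDilating`), so the inputs are `hBmon_i : IsMonoidOn B_i`
([FrdI] Thm. 5.2 preamble "`𝔹` a monoid on `D`", not recorded by `RealifiedDivisorMonoids`) and the data
binders of row C38-L05 ONLY (plus the named fact `h34`). [cite: MochizukiEtTh2009, Cor 3.8 p.80] -/
theorem Cor38Hyp.cor38_i_treeVocab_of_thm34ii
    (h34 : Literature.AlgebraicGeometry.Frobenioids.FrdI.Thm34ii.{w, v, max v w, u, max u w})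
    (hBmon₁ : IsMonoidOn C₁.ratFnFunctor) (hBmon₂ : IsMonoidOn C₂.ratFnFunctor)
    (hP34Λ₁ : ∀ (Y : D₀ᵒᵖ) (b : T₁.BΛ.obj Y) (r : T₁.ΦR.obj Y),
      T₁.divΛ Y b = Algebra.GrothendieckGroup.of r → b ∈ T₁.FΛ Y)
    (hLine₁ : ∀ (Y : D₀ᵒᵖ) (g : Algebra.GrothendieckGroup (T₁.ΦR.obj Y)), g ∈ T₁.cnstR Y →
      ∃ r : T₁.ΦR.obj Y, g = Algebra.GrothendieckGroup.of r ∨ g = (Algebra.GrothendieckGroup.of r)⁻¹)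
    (hInt₁ : ∀ Y : D₀ᵒᵖ, IsCancelMul (T₁.ΦR.obj Y))
    (hSup₁ : ∀ (W : D) (m : Perfection (C₁.divisorMonoid.obj (op W)))
      (U : Set (Perfection (C₁.divisorMonoid.obj (op W)))),
      U ⊆ C₁.bsFldPf W → U.Nonempty → (∀ u ∈ U, u ∣ m) →
        ∃ y ∈ C₁.bsFldPf W, (∀ u ∈ U, u ∣ y) ∧ y ∣ m)
    (hP34Λ₂ : ∀ (Y : D₀'ᵒᵖ) (b : T₂.BΛ.obj Y) (r : T₂.ΦR.obj Y),
      T₂.divΛ Y b = Algebra.GrothendieckGroup.of r → b ∈ T₂.FΛ Y)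
    (hLine₂ : ∀ (Y : D₀'ᵒᵖ) (g : Algebra.GrothendieckGroup (T₂.ΦR.obj Y)), g ∈ T₂.cnstR Y →
      ∃ r : T₂.ΦR.obj Y, g = Algebra.GrothendieckGroup.of r ∨ g = (Algebra.GrothendieckGroup.of r)⁻¹)
    (hInt₂ : ∀ Y : D₀'ᵒᵖ, IsCancelMul (T₂.ΦR.obj Y))
    (hSup₂ : ∀ (W : D') (m : Perfection (C₂.divisorMonoid.obj (op W)))
      (U : Set (Perfection (C₂.divisorMonoid.obj (op W)))),
      U ⊆ C₂.bsFldPf W → U.Nonempty → (∀ u ∈ U, u ∣ m) →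
        ∃ y ∈ C₂.bsFldPf W, (∀ u ∈ U, u ∣ y) ∧ y ∣ m) :
    Literature.AnabelianGeometry.EtaleTheta.Cor38_i
      (fun E _ => Literature.AlgebraicGeometry.Frobenioids.IsFrobeniusSlim E) h :=
  h.cor38_i_of_thm34ii h34 (C₁.isFrobenioid_treeCatVocab_of_isMonoidOn hBmon₁)
    (C₂.isFrobenioid_treeCatVocab_of_isMonoidOn hBmon₂)
    (C₁.opsData_isOfStandardType_treeCatVocab hBmon₁ h.fsmff.1 h.nonDilating.1)
    (C₂.opsData_isOfStandardType_treeCatVocab hBmon₂ h.fsmff.2 h.nonDilating.2)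
    hP34Λ₁ hLine₁ hInt₁ hSup₁ hP34Λ₂ hLine₂ hInt₂ hSup₂

end TreeVocab

end Literature.AnabelianGeometry.EtaleTheta
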